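import Summits.QuantumAdvantage.AdviceFreeQNC0.AffBells24ExposedSupport
import HarnessLib

/-!
# THEOREM S (planner qn-p1 g25, ROUND-24 §2.9; ask P-25c): the SYMMETRIC class relations, for EVERY size `Z` —
# `symRelEven : SymRelEven`, `symRelOdd : SymRelOdd` and **`notFullSupportRigiditySucc : NotFullSupportRigiditySucc`**
# (`¬ FullSupportRigidity (Z₀ + 1) Z₀` for all `Z₀ ≥ 3`)

The statements of `HOME/qa-qnc0-p1/exp25/Sketch25S.lean` (`symRowEven`, `SymRelEven`, `NotFullSupportRigiditySucc` and the `decide`d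
instance `Z = 4`) are repeated VERBATIM; new here (prover seat qn-prover-3 g13) are the all-`Z` proofs:

* `test_symRow` — for a row `𝟙 + e_i` the MOD₃ test at `y` reads `[w(y) + y_i ≡ c]` (`w` = number of ones);
* **`symRelEven`** — even `Z ≥ 4`: on the parity class `P₀` the XOR of the `Z` tests `[w + y_i ≡ 0]` vanishes (the firing tests
  are those with `y_i = 0` if `w ≡ 0`, with `y_i = 1` if `w ≡ 2`, none if `w ≡ 1` — `Z − w`, `w`, `0` of them, all EVEN);
* `symRowOdd`, **`symRelOdd`** — odd `Z ≥ 3`: the `Z + 1` tests `[w ≡ 0]`, `[w + y_i ≡ 1]` do the same on `P₁` (`1 + w`, `Z − w`, `0`);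
* **`notFullSupportRigiditySucc : ∀ Z₀ ≥ 3, ¬ FullSupportRigidity (Z₀ + 1) Z₀`** — the rows are full-support and pairwise
  non-parallel, so these are genuine (non-R1) relations with `K = Z₀` (even) / `Z₀ + 1` (odd) rows: the rigidity threshold of
  `FullSupportRigidity K₀ Z₀` can hold only for `K₀ < Z₀` (complementing the planner's Theorem B/B′ window `[Z/2+1, 2⌈Z/2⌉]`).

WHAT THIS IS NOT: nothing on the positive side (Theorem B′ `StrongFullSupportRigidityLin`, typed in `AffBells25FullSupportRigidity.lean`,
is open in the tree); instrument for crux stmt-QuantumAdvantage-22907 (route DWalkThree); separation NOT moved.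
-/

namespace Summit.QuantumAdvantage.AdviceFreeQNC0

namespace AffBells25

open Finset AffBells24

/-! ### Statements (Sketch25S, verbatim) -/

/-- Symmetric rows for even `Z`: row `i` is `𝟙 + e_i` (entry `2` at `i`, `1` elsewhere). -/
def symRowEven (Z : ℕ) (i : Fin Z) (e : Fin Z) : ZMod 3 := if e = i then 2 else 1

/-- THEOREM S, even case (target, all even `Z ≥ 4`): the symmetric XOR is `false` on `P₀`. -/
def SymRelEven : Prop :=
  ∀ Z : ℕ, 4 ≤ Z → Z % 2 = 0 →
    ∀ y ∈ parityClass Z 0, xorTests (symRowEven Z) (fun _ => (0 : ZMod 3)) y = false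

/-- Consequence (target): the symmetric system refutes rigidity with `K₀ = Z₀ + 1` rows from `Z₀ = 3` on. -/
def NotFullSupportRigiditySucc : Prop :=
  ∀ Z₀ : ℕ, 3 ≤ Z₀ → ¬ FullSupportRigidity (Z₀ + 1) Z₀

/-! ### Kernel checks at `Z = 4` (Sketch25S, verbatim) -/

/-- `Z = 4`: the symmetric XOR vanishes on `P₀`. -/
theorem symRelEven_four :
    ∀ y ∈ parityClass 4 0, xorTests (symRowEven 4) (fun _ => (0 : ZMod 3)) y = false := by
  decide

/-- `Z = 4`: the symmetric XOR is not identically zero on the cube. -/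
theorem symRelEven_four_nonconst :
    ∃ y : Fin 4 → Bool, xorTests (symRowEven 4) (fun _ => (0 : ZMod 3)) y = true := by
  decide

/-- `Z = 4`: full support. -/
theorem symRowEven_four_full : ∀ g e, symRowEven 4 g e ≠ 0 := by decide

/-- `Z = 4`: row `0` is lonely. -/
theorem symRowEven_four_lonely :
    ∀ g : Fin 4, g ≠ 0 → ¬ (symRowEven 4 g = symRowEven 4 0 ∨ symRowEven 4 g = -symRowEven 4 0) := by
  decide

/-- `FullSupportRigidity 5 4` is false (so is `FullSupportRigidity K₀ 4` for every `K₀ ≥ 4`). -/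
theorem not_fullSupportRigidity_five_four : ¬ FullSupportRigidity 5 4 := by
  intro h
  obtain ⟨y, hy, hne⟩ :=
    h 4 4 0 le_rfl (by norm_num) (symRowEven 4) (fun _ => 0) 0 symRowEven_four_full
      symRowEven_four_lonely false
  exact hne (symRelEven_four y hy)

/-! ### The rows `𝟙 + e_i` read `w(y) + y_i` -/

variable {Z : ℕ}

/-- Number of ones of `y`. -/
def wt1 (y : Fin Z → Bool) : ℕ := (univ.filter fun e => y e = true).card

/-- A row with entry `2` at `i` and `1` elsewhere tests `[w(y) + y_i ≡ c]`. -/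
theorem sum_row_plus (y : Fin Z → Bool) (i : Fin Z) :
    (∑ e : Fin Z, if y e = true then (if e = i then (2 : ZMod 3) else 1) else 0) =
      (wt1 y : ZMod 3) + (if y i = true then 1 else 0) := by
  have e1 : ∀ e : Fin Z, (if y e = true then (if e = i then (2 : ZMod 3) else 1) else 0) =
      (if y e = true then (1 : ZMod 3) else 0) + (if (y e = true ∧ e = i) then 1 else 0) := by
    intro e
    by_cases h1 : y e = true
    · rw [if_pos h1, if_pos h1]
      by_cases h2 : e = i
      · rw [if_pos h2, if_pos ⟨h1, h2⟩]; decide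
      · rw [if_neg h2, if_neg (fun h => h2 h.2), add_zero]
    · rw [if_neg h1, if_neg h1, if_neg (fun h => h1 h.1), add_zero]
  rw [Finset.sum_congr rfl fun e _ => e1 e, Finset.sum_add_distrib]
  unfold wt1
  rw [Finset.natCast_card_filter]
  congr 1
  rw [Finset.sum_eq_single i]
  · simp
  · intro e _ hei; simp [hei]
  · intro h; exact absurd (mem_univ i) h

/-- The all-ones row tests `[w(y) ≡ c]`. -/
theorem sum_row_ones (y : Fin Z → Bool) :
    (∑ e : Fin Z, if y e = true then (1 : ZMod 3) else 0) = (wt1 y : ZMod 3) := by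
  unfold wt1
  rw [Finset.natCast_card_filter]

/-- The even-case test of row `i`: `[w(y) + y_i ≡ 0]`. -/
theorem test_symRowEven (y : Fin Z → Bool) (i : Fin Z) :
    test (symRowEven Z i) 0 y = decide ((wt1 y : ZMod 3) + (if y i = true then 1 else 0) = 0) := by
  unfold test symRowEven
  rw [sum_row_plus]

/-- The residue of `w` mod 3 as an element of `ZMod 3`. -/
private theorem natCast_eq_of_mod (w r : ℕ) (h : w % 3 = r) : (w : ZMod 3) = (r : ZMod 3) := by
  rw [← ZMod.natCast_mod w 3, h]

/-- **The number of firing symmetric tests**, by the residue of `w(y)` mod 3: `Z − w`, `0`, `w`. -/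
theorem card_firing_even (y : Fin Z → Bool) :
    (univ.filter fun i : Fin Z => test (symRowEven Z i) 0 y = true).card =
      if wt1 y % 3 = 0 then Z - wt1 y else if wt1 y % 3 = 1 then 0 else wt1 y := by
  have hw3 : wt1 y % 3 = 0 ∨ wt1 y % 3 = 1 ∨ wt1 y % 3 = 2 := by omega
  have hcompl : (univ.filter fun e : Fin Z => y e = false).card = Z - wt1 y := by
    have h := Finset.card_filter_add_card_filter_not (s := (univ : Finset (Fin Z))) (fun e => y e = true)
    rw [card_univ, Fintype.card_fin] at h
    have e : (univ.filter fun e : Fin Z => ¬ y e = true) = univ.filter fun e : Fin Z => y e = false :=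
      filter_congr fun e _ => by cases y e <;> simp
    rw [e] at h
    unfold wt1
    omega
  rcases hw3 with h0 | h1 | h2
  · rw [if_pos h0, ← hcompl]
    congr 1
    refine filter_congr fun i _ => ?_
    rw [test_symRowEven, natCast_eq_of_mod _ 0 h0, decide_eq_true_eq]
    cases y i <;> simp
  · rw [if_neg (show ¬ wt1 y % 3 = 0 by omega), if_pos h1, Finset.card_eq_zero, filter_eq_empty_iff]
    intro i _
    rw [test_symRowEven, natCast_eq_of_mod _ 1 h1, decide_eq_true_eq]
    cases y i <;> decide
  · rw [if_neg (show ¬ wt1 y % 3 = 0 by omega), if_neg (show ¬ wt1 y % 3 = 1 by omega)]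
    have e : (univ.filter fun i : Fin Z => test (symRowEven Z i) 0 y = true) = univ.filter fun i : Fin Z => y i = true := by
      refine filter_congr fun i _ => ?_
      rw [test_symRowEven, natCast_eq_of_mod _ 2 h2, decide_eq_true_eq]
      cases y i <;> decide
    rw [e]
    rfl

/-- Parity bookkeeping of the even case. -/
private theorem key_even (Z w : ℕ) (hZ : Z % 2 = 0) (hw : w % 2 = 0) :
    ¬ ((if w % 3 = 0 then Z - w else if w % 3 = 1 then 0 else w) % 2 = 1) := by
  by_cases h0 : w % 3 = 0
  · rw [if_pos h0]; omega
  · rw [if_neg h0]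
    by_cases h1 : w % 3 = 1
    · rw [if_pos h1]; omega
    · rw [if_neg h1]; omega

/-- **THEOREM S, even case — PROVED for every even `Z ≥ 4`** (in fact every even `Z`). -/
theorem symRelEven : SymRelEven := by
  intro Z _ hZ y hy
  unfold parityClass at hy
  rw [mem_filter] at hy
  have hw : wt1 y % 2 = 0 := hy.2
  unfold xorTests
  rw [card_firing_even]
  exact decide_eq_false (key_even Z (wt1 y) hZ hw)

/-! ### The odd family: `[w ≡ 0]` and `[w + y_i ≡ 1]` -/

/-- Symmetric rows for odd `Z`: row `0` is `𝟙` (test `[w ≡ 0]`), row `i + 1` is `𝟙 + e_i` (test `[w + y_i ≡ 1]`). -/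
def symRowOdd (Z : ℕ) (g : Fin (Z + 1)) (e : Fin Z) : ZMod 3 := if g.val = e.val + 1 then 2 else 1

/-- Offsets of the odd family: `0` for row `0`, `1` for the rows `i + 1`. -/
def symOffOdd (Z : ℕ) (g : Fin (Z + 1)) : ZMod 3 := if g.val = 0 then 0 else 1

/-- THEOREM S, odd case (target): for odd `Z ≥ 3` the XOR of the odd family is `false` on `P₁`. -/
def SymRelOdd : Prop :=
  ∀ Z : ℕ, 3 ≤ Z → Z % 2 = 1 →
    ∀ y ∈ parityClass Z 1, xorTests (symRowOdd Z) (symOffOdd Z) y = false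

/-- Row `0` of the odd family tests `[w ≡ 0]`. -/
theorem test_symRowOdd_zero (y : Fin Z → Bool) :
    test (symRowOdd Z 0) (symOffOdd Z 0) y = decide ((wt1 y : ZMod 3) = 0) := by
  unfold test symRowOdd symOffOdd
  have e : (∑ e : Fin Z, if y e = true then (if (0 : Fin (Z + 1)).val = e.val + 1 then (2 : ZMod 3) else 1) else 0) =
      ∑ e : Fin Z, if y e = true then (1 : ZMod 3) else 0 :=
    Finset.sum_congr rfl fun e _ => by simp
  rw [e, sum_row_ones]
  simp

/-- Row `i + 1` of the odd family tests `[w + y_i ≡ 1]`. -/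
theorem test_symRowOdd_succ (y : Fin Z → Bool) (i : Fin Z) :
    test (symRowOdd Z i.succ) (symOffOdd Z i.succ) y =
      decide ((wt1 y : ZMod 3) + (if y i = true then 1 else 0) = 1) := by
  unfold test symRowOdd symOffOdd
  have e : (∑ e : Fin Z, if y e = true then (if (i.succ).val = e.val + 1 then (2 : ZMod 3) else 1) else 0) =
      ∑ e : Fin Z, if y e = true then (if e = i then (2 : ZMod 3) else 1) else 0 := by
    refine Finset.sum_congr rfl fun e _ => ?_
    have : ((i.succ).val = e.val + 1) ↔ (e = i) := by
      rw [Fin.val_succ]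
      constructor
      · intro h; ext; omega
      · rintro rfl; rfl
    simp only [this]
  rw [e, sum_row_plus]
  simp

/-- **The number of firing tests of the odd family**: `1 + w`, `Z − w`, `0` by the residue of `w` mod 3. -/
theorem card_firing_odd (y : Fin Z → Bool) :
    (univ.filter fun g : Fin (Z + 1) => test (symRowOdd Z g) (symOffOdd Z g) y = true).card =
      if wt1 y % 3 = 0 then 1 + wt1 y else if wt1 y % 3 = 1 then Z - wt1 y else 0 := by
  have hcompl : (univ.filter fun e : Fin Z => y e = false).card = Z - wt1 y := by
    have h := Finset.card_filter_add_card_filter_not (s := (univ : Finset (Fin Z))) (fun e => y e = true)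
    rw [card_univ, Fintype.card_fin] at h
    have e : (univ.filter fun e : Fin Z => ¬ y e = true) = univ.filter fun e : Fin Z => y e = false :=
      filter_congr fun e _ => by cases y e <;> simp
    rw [e] at h
    unfold wt1
    omega
  -- split off row `0`
  rw [Finset.card_filter, Fin.sum_univ_succ, test_symRowOdd_zero]
  simp_rw [test_symRowOdd_succ]
  rw [← Finset.card_filter]
  have hw3 : wt1 y % 3 = 0 ∨ wt1 y % 3 = 1 ∨ wt1 y % 3 = 2 := by omega
  rcases hw3 with h0 | h1 | h2
  · rw [if_pos h0, natCast_eq_of_mod _ 0 h0]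
    have e : (univ.filter fun i : Fin Z => decide ((((0 : ℕ) : ZMod 3)) + (if y i = true then 1 else 0) = 1) = true) =
        univ.filter fun i : Fin Z => y i = true := filter_congr fun i _ => by cases y i <;> decide
    have e0 : (if decide ((((0 : ℕ) : ZMod 3)) = 0) = true then 1 else 0) = 1 := by decide
    rw [e, e0]
    rfl
  · rw [if_neg (show ¬ wt1 y % 3 = 0 by omega), if_pos h1, natCast_eq_of_mod _ 1 h1, ← hcompl]
    have e : (univ.filter fun i : Fin Z => decide ((((1 : ℕ) : ZMod 3)) + (if y i = true then 1 else 0) = 1) = true) =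
        univ.filter fun i : Fin Z => y i = false := filter_congr fun i _ => by cases y i <;> decide
    have e0 : (if decide ((((1 : ℕ) : ZMod 3)) = 0) = true then 1 else 0) = 0 := by decide
    rw [e, e0, zero_add]
  · rw [if_neg (show ¬ wt1 y % 3 = 0 by omega), if_neg (show ¬ wt1 y % 3 = 1 by omega), natCast_eq_of_mod _ 2 h2]
    have e : (univ.filter fun i : Fin Z => decide ((((2 : ℕ) : ZMod 3)) + (if y i = true then 1 else 0) = 1) = true) = ∅ := by
      rw [filter_eq_empty_iff]; intro i _; cases y i <;> decide
    have e0 : (if decide ((((2 : ℕ) : ZMod 3)) = 0) = true then 1 else 0) = 0 := by decide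
    rw [e, e0, card_empty]

/-- Parity bookkeeping of the odd case. -/
private theorem key_odd (Z w : ℕ) (hZ : Z % 2 = 1) (hw : w % 2 = 1) :
    ¬ ((if w % 3 = 0 then 1 + w else if w % 3 = 1 then Z - w else 0) % 2 = 1) := by
  by_cases h0 : w % 3 = 0
  · rw [if_pos h0]; omega
  · rw [if_neg h0]
    by_cases h1 : w % 3 = 1
    · rw [if_pos h1]; omega
    · rw [if_neg h1]; omega

/-- **THEOREM S, odd case — PROVED for every odd `Z ≥ 3`** (in fact every odd `Z`). -/
theorem symRelOdd : SymRelOdd := by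
  intro Z _ hZ y hy
  unfold parityClass at hy
  rw [mem_filter] at hy
  have hw : wt1 y % 2 = 1 := hy.2
  unfold xorTests
  rw [card_firing_odd]
  exact decide_eq_false (key_odd Z (wt1 y) hZ hw)

/-! ### The refutation of `FullSupportRigidity (Z₀ + 1) Z₀` for every `Z₀ ≥ 3` -/

/-- The even rows are full-support. -/
theorem symRowEven_full (Z : ℕ) : ∀ g e, symRowEven Z g e ≠ 0 := by
  intro g e; unfold symRowEven; split_ifs <;> decide

/-- The odd rows are full-support. -/
theorem symRowOdd_full (Z : ℕ) : ∀ g e, symRowOdd Z g e ≠ 0 := by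
  intro g e; unfold symRowOdd; split_ifs <;> decide

/-- Row `0` of the even family is lonely (`Z ≥ 3`). -/
theorem symRowEven_lonely {Z : ℕ} (hZ : 3 ≤ Z) :
    ∀ g : Fin Z, g ≠ ⟨0, by omega⟩ →
      ¬ (symRowEven Z g = symRowEven Z ⟨0, by omega⟩ ∨ symRowEven Z g = -symRowEven Z ⟨0, by omega⟩) := by
  intro g hg h
  rcases h with h | h
  · have h1 := congrFun h g
    unfold symRowEven at h1
    rw [if_pos rfl, if_neg hg] at h1
    exact absurd h1 (by decide)
  · -- a third coordinate `e ∉ {0, g}` carries `1` on the left and `2` on the right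
    have hg0 : g.val ≠ 0 := fun h0 => hg (Fin.ext h0)
    obtain ⟨e, he0, heg⟩ : ∃ e : Fin Z, e.val ≠ 0 ∧ e ≠ g := by
      by_cases h1 : g.val = 1
      · exact ⟨⟨2, by omega⟩, by simp, fun h => by rw [← h] at h1; simp at h1⟩
      · exact ⟨⟨1, by omega⟩, by simp, fun h => by rw [← h] at h1; simp at h1⟩
    have h1 := congrFun h e
    unfold symRowEven at h1
    simp only [Pi.neg_apply] at h1
    rw [if_neg heg, if_neg (fun h => he0 (by rw [h]))] at h1
    exact absurd h1 (by decide)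

/-- Row `0` of the odd family is lonely (`Z ≥ 2`). -/
theorem symRowOdd_lonely {Z : ℕ} (hZ : 2 ≤ Z) :
    ∀ g : Fin (Z + 1), g ≠ 0 → ¬ (symRowOdd Z g = symRowOdd Z 0 ∨ symRowOdd Z g = -symRowOdd Z 0) := by
  intro g hg h
  have hg0 : g.val ≠ 0 := fun h0 => hg (Fin.ext h0)
  have hgZ := g.isLt
  rcases h with h | h
  · have h1 := congrFun h ⟨g.val - 1, by omega⟩
    unfold symRowOdd at h1
    rw [if_pos (by simp; omega), if_neg (by simp)] at h1
    exact absurd h1 (by decide)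
  · obtain ⟨e, he⟩ : ∃ e : Fin Z, g.val ≠ e.val + 1 := by
      by_cases h1 : g.val = 1
      · exact ⟨⟨1, by omega⟩, by simp [h1]⟩
      · exact ⟨⟨0, by omega⟩, h1⟩
    have h1 := congrFun h e
    unfold symRowOdd at h1
    simp only [Pi.neg_apply] at h1
    rw [if_neg he, if_neg (by simp)] at h1
    exact absurd h1 (by decide)

/-- **`NotFullSupportRigiditySucc` — PROVED**: for every `Z₀ ≥ 3`, `FullSupportRigidity (Z₀ + 1) Z₀` fails (even `Z₀`: the `Z₀`
rows `𝟙 + e_i` on `P₀`; odd `Z₀`: the `Z₀ + 1` rows `𝟙`, `𝟙 + e_i` on `P₁`). -/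
theorem notFullSupportRigiditySucc : NotFullSupportRigiditySucc := by
  intro Z₀ hZ₀ h
  rcases Nat.even_or_odd Z₀ with he | ho
  · have hZe : Z₀ % 2 = 0 := Nat.even_iff.1 he
    obtain ⟨y, hy, hne⟩ := h Z₀ Z₀ 0 le_rfl (by omega) (symRowEven Z₀) (fun _ => 0) ⟨0, by omega⟩
      (symRowEven_full Z₀) (symRowEven_lonely hZ₀) false
    exact hne (symRelEven Z₀ (by omega) hZe y hy)
  · have hZo : Z₀ % 2 = 1 := Nat.odd_iff.1 ho
    obtain ⟨y, hy, hne⟩ := h Z₀ (Z₀ + 1) 1 le_rfl le_rfl (symRowOdd Z₀) (symOffOdd Z₀) 0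
      (symRowOdd_full Z₀) (symRowOdd_lonely (by omega)) false
    exact hne (symRelOdd Z₀ hZ₀ hZo y hy)

end AffBells25

end Summit.QuantumAdvantage.AdviceFreeQNC0
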